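import Summits.AtomisticToContinuum.HydrodynamicLimit.Theorems.RelayRaceLocalityNearConstantShortTimeHLAssemblyTheta
import HarnessLib

/-!
# Crux `NearConstantShortTimeHL` (stmt-AtomisticToContinuum-12502), line `small-tilt-domination` — St2′ along one Euler solution

Stub `st2_along_solution` of the Grönwall assembly (`stub_gronwallAssembly`, route: Yau's relative-entropy method with the
energy-weighted mesoscale fluctuation functional `fluctuationE`). The statics input St2′ = `MesoscaleSuperlinearityE` is the
exponential-moment large-deviation bound `∫ exp(γ n_N · fluctuationE ℓ_{n_N} ρ₁ θ₁ u₁) dQ_N ≤ exp(κ n_N)` (eventually in `N`,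
for every `κ > 0`), uniform over all continuous unit-mass profiles `(ρ₁, u₁, θ₁)` in an `M`-box (`M⁻¹ ≤ ρ₁`, `ρ₁σ³ ≤ η₁`,
`θ₁ ∈ [M⁻¹, M]`, `‖u₁‖ ≤ M`, all `M`-Lipschitz) under the matched canonical local Gibbs law `Q_N`. The assembly consumes it only
ALONG the time slices `(ρ_r, u_r, θ_r)`, `r ∈ [0, t]`, of one classical hard-sphere Euler solution on `[0, T)`, `t < T`, which sit
in one box `Mb` (hypothesis, supplied by the neighbour stub `solution_box`), with the reference law written as
`particleLaw (Φ N) (canonicalDensity …)` and the excess chemical potential written as `gChem σ`.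

* `st2_along_solution` — the specialisation. Proof: pure bookkeeping — the slices are continuous (joint smoothness of the
  solution, `IsSmoothSpaceTimeOn.isSmooth_slice`), the box conjuncts are reordered, `particleLaw Φ W = (liouville …).withDensity
  (ofReal ∘ W)` is the unfolding lemma `particleLaw_eq`, and St2′'s `let g` is `gChem σ` by definition.
-/

noncomputable section

namespace Summit.AtomisticToContinuum.HydrodynamicLimit.Theorems.NearConstantShortTimeHL

open scoped BigOperators ENNReal Topology
open MeasureTheory Set Filter
open Literature.MathematicalPhysics.KineticTheory Literature.Analysis.FluidPDE Literature.Analysis.FunctionSpaces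

/-- **St2′ along one Euler solution.** If `MesoscaleSuperlinearityE` holds with packing threshold `η₁`, then for every classical
hard-sphere Euler solution `(ρ, u, θ)` on `[0, T)` at reduced diameter `σ > 0`, every `t < T` with nominal packing `ρσ³ ≤ η₁` and
unit mass on `[0, t]`, every box `Mb ≥ 1` containing all slices `(ρ_r, u_r, θ_r)`, `r ∈ [0, t]` (lower bounds `Mb⁻¹ ≤ ρ_r, θ_r`,
upper bounds `θ_r, ‖u_r‖ ≤ Mb`, `Mb`-Lipschitz), and every admissible family `(ε_N > 0, ε_N → 0, n_N ε_N³ → σ³)` of hard-sphere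
flows, there is `γ > 0` with: for every `κ > 0`, eventually in `N`, for all `r ∈ [0, t]`,
`∫ exp(γ n_N · fluctuationE ℓ_{n_N} ρ_r θ_r u_r) d(particleLaw (Φ N) (canonical local Gibbs law of (ρ_r e^{g_σ(ρ_r)}, u_r, θ_r)))
≤ exp(κ n_N)`. [cite: Yau1991, §2] -/
theorem st2_along_solution : MesoscaleSuperlinearityE → ∃ ηS : ℝ, 0 < ηS ∧ ∀ {σ T : ℝ}, 0 < σ → ∀ {ρ θ : ℝ → T3 → ℝ} {u : ℝ → T3 → V3}, IsHardSphereEulerSolution σ T ρ u θ → ∀ {t : ℝ}, t ∈ Set.Ico 0 T → (∀ s ∈ Set.Icc 0 t, ∀ x, ρ s x * σ ^ 3 ≤ ηS) → (∀ r ∈ Set.Icc 0 t, ∫ x, ρ r x = 1) → ∀ {Mb : ℝ}, 1 ≤ Mb → (∀ r ∈ Set.Icc 0 t, (∀ x, Mb⁻¹ ≤ ρ r x ∧ Mb⁻¹ ≤ θ r x ∧ θ r x ≤ Mb ∧ ‖u r x‖ ≤ Mb) ∧ (∀ x y, |ρ r x - ρ r y| ≤ Mb * dist x y ∧ ‖u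 r x - u r y‖ ≤ Mb * dist x y ∧ |θ r x - θ r y| ≤ Mb * dist x y)) → ∀ {ε : ℕ → ℝ} {n : ℕ → ℕ}, (∀ N, 0 < ε N) → Tendsto ε atTop (nhds 0) → Tendsto (fun N => (n N : ℝ) * ε N ^ 3) atTop (nhds (σ ^ 3)) → ∀ (Φ : (N : ℕ) → HardSphereFlow (Torus.geometry (Fin 3)) (ε N) (n N)), ∃ γ : ℝ, 0 < γ ∧ ∀ κ : ℝ, 0 < κ → ∀ᶠ N : ℕ in atTop, ∀ r ∈ Set.Icc 0 t, ∫⁻ w, ENNReal.ofReal (Real.exp (γ * (n N : ℝ) * fluctuationE (mesoRadius (n N)) (ρ r) (θ r) (u r) w)) ∂(particleLaw (Φ N) (canonicalDensity (Torus.geometry (Fin 3)) (ε N) (n N) (localGibbsProfile (fun x => ρ r x * Real.exp (gChem σ (ρ r x))) (u r) (θ r)))) ≤ ENNReal.ofReal (Real.exp (κ * (n N : ℝ))) := by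
  rintro ⟨η₁, hη₁, H⟩
  refine ⟨η₁, hη₁, ?_⟩
  intro σ T hσ ρ θ u hE t ht hband hmass Mb hMb hbox ε n hε hε0 hnσ Φ
  obtain ⟨γ, hγ, Hκ⟩ := H Mb hMb σ hσ ε n hε hε0 hnσ
  refine ⟨γ, hγ, fun κ hκ => ?_⟩
  filter_upwards [Hκ κ hκ] with N hN
  intro r hr
  have hrT : r ∈ Set.Ico 0 T := ⟨hr.1, hr.2.trans_lt ht.2⟩
  have hρc : Continuous (ρ r) := (hE.smooth_density.isSmooth_slice hrT).continuous
  have hθc : Continuous (θ r) := (hE.smooth_temperature.isSmooth_slice hrT).continuous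
  have huc : Continuous (u r) := (hE.smooth_velocity.isSmooth_slice hrT).continuous
  have hbox' : ∀ x, Mb⁻¹ ≤ ρ r x ∧ ρ r x * σ ^ 3 ≤ η₁ ∧ Mb⁻¹ ≤ θ r x ∧ θ r x ≤ Mb ∧ ‖u r x‖ ≤ Mb := fun x =>
    ⟨((hbox r hr).1 x).1, hband r hr x, ((hbox r hr).1 x).2.1, ((hbox r hr).1 x).2.2.1, ((hbox r hr).1 x).2.2.2⟩
  have key := hN (ρ r) (θ r) (u r) hρc hθc huc (hmass r hr) hbox' (hbox r hr).2
  simpa only [particleLaw_eq, gChem] using key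

end Summit.AtomisticToContinuum.HydrodynamicLimit.Theorems.NearConstantShortTimeHL

end
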